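import Summits.CriticalPhenomena.Ising3D.TaylorTableTheorem
import Summits.CriticalPhenomena.Ising3D.TaylorTableOddHeadReg
import Mathlib.Tactic.Linarith
import Mathlib.Tactic.Positivity
import Mathlib.Tactic.Ring
import HarnessLib

/-!
# The TABLE layer of a derivative certificate, IX: `BoxExcluded` from a rational table with REGULARISED odd enclosures
(cell `pub-ising3x`, seat boot-1 gen 6; gate (g2) — the table theorem in the form a complete certificate uses)

HONEST FRAMING: lottery ticket; floor = tightest certified 3D Ising CFT bounds; no exact-solution
claim without a proof. Island framing: certified exclusion region at stated derivative order and
assumptions; not a determination of the 3D Ising critical exponents beyond that.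

Same data `TaylorTable`, same Boolean `T.check` as `TaylorTableTheorem`; the only change is the MEANING of
the odd cells' coefficient intervals: `T.EnclosuresReg` asks them to enclose the REGULARISED triple
`(Δ - b_ℓ)·(cₛ, c₊, c₋)` (`oddCoeffsReg`), which stays bounded on cells touching the unitarity bound where the
mixed-block coefficients themselves have a pole — so that the first odd cell of every spin is certifiable
(`oddHead_nonneg_of_kdCheck_reg`, using the strict hypothesis `b_ℓ < Δ` that `of_oddCover` hands to head
cells). THEOREM `TaylorTable.boxExcluded_of_taylorTable_reg`:
`T.check = true → T.EnclosuresReg → TaylorEvenRegion T.α T.box E₀ → T.OddCone → BoxExcluded T.box`.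
Sources: Kos–Poland–Simmons-Duffin 2014 §3.3 eq. (3.16), §4 (pole at the bound).
-/

namespace Summit.CriticalPhenomena.Ising3D

open Finset Set
open Literature.MathematicalPhysics.QuantumFieldTheory.ConformalBootstrap3D
open Literature.Analysis.ValidatedNumerics

namespace TaylorTable

variable (T : TaylorTable)

/-- HYPOTHESIS 1 in regularised form: even enclosures as in `Enclosures`; odd enclosures of the REGULARISED
coefficient triple `(Δ - b_ℓ)(cₛ, c₊, c₋)` on box × cell. [cite: KosPolandSimmonsduffin2014, §3.3 eq. (3.16)] -/
def EnclosuresReg : Prop :=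
  (∀ C ∈ T.evenCells, ∀ Δ : ℝ, (C.lo : ℝ) ≤ Δ → Δ ≤ C.hi → ∀ (i : ℕ) (q : ℕ × ℕ) (I : ℚ × ℚ),
      C.F[i]? = some q → C.A[i]? = some I →
      (I.1 : ℝ) ≤ hrCoeff Δ C.ℓ q.1 q.2 / legendreLam C.ℓ ∧ hrCoeff Δ C.ℓ q.1 q.2 / legendreLam C.ℓ ≤ (I.2 : ℝ)) ∧
  (∀ C ∈ T.oddCells, ∀ p ∈ T.box, ∀ Δ : ℝ, (C.lo : ℝ) ≤ Δ → Δ ≤ C.hi →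
      ∀ (i : ℕ) (q : ℕ × ℕ) (I : (ℚ × ℚ) × (ℚ × ℚ) × (ℚ × ℚ)), C.F[i]? = some q → C.A[i]? = some I →
        ((I.1.1 : ℝ) ≤ (oddCoeffsReg p.1 p.2 Δ C.ℓ q).1 ∧ (oddCoeffsReg p.1 p.2 Δ C.ℓ q).1 ≤ (I.1.2 : ℝ)) ∧
        ((I.2.1.1 : ℝ) ≤ (oddCoeffsReg p.1 p.2 Δ C.ℓ q).2.1 ∧ (oddCoeffsReg p.1 p.2 Δ C.ℓ q).2.1 ≤ (I.2.1.2 : ℝ)) ∧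
        ((I.2.2.1 : ℝ) ≤ (oddCoeffsReg p.1 p.2 Δ C.ℓ q).2.2 ∧ (oddCoeffsReg p.1 p.2 Δ C.ℓ q).2.2 ≤ (I.2.2.2 : ℝ)))

/-- **THE TABLE THEOREM (g2) with regularised odd enclosures, field form.** If the decidable part of a rational
kind-`deriv` table passes, its even enclosures and REGULARISED odd enclosures are valid, the even region field
holds and the odd cone holds, then the box is excluded. [cite: KosPolandSimmonsduffin2014, §3.3 eq. (3.16)] -/
theorem boxExcluded_of_taylorTable_reg (h : T.check = true) (hEnc : T.EnclosuresReg)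
    (hR : TaylorEvenRegion T.α T.box ((T.E₀ : ℚ) : ℝ)) (hC : T.OddCone) : BoxExcluded T.box := by
  -- unpack the Boolean
  simp only [check, Bool.and_eq_true] at h
  obtain ⟨⟨⟨⟨⟨hB, hI⟩, hEcells⟩, hEcov⟩, hOcells⟩, hOcov⟩ := h
  simp only [checkBasic, Bool.and_eq_true, decide_eq_true_eq] at hB
  obtain ⟨⟨⟨⟨⟨⟨⟨⟨hL, hLψ⟩, hκ₀⟩, hσlo⟩, hσhi⟩, hgap⟩, hE₀⟩, hLE⟩, hLT⟩ := hB
  simp only [checkIdentity, Bool.and_eq_true, decide_eq_true_eq] at hI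
  obtain ⟨⟨⟨⟨hκ, hμσ⟩, hμε⟩, hbI⟩, htI⟩ := hI
  obtain ⟨hκhi, hκr₁, hκr₂, hκ₁, hκ₂⟩ := PowEncl.check_spec hκ
  obtain ⟨hμσhi, hμσr₁, hμσr₂, hμσ₁, hμσ₂⟩ := PowEncl.check_spec hμσ
  obtain ⟨hμεhi, hμεr₁, hμεr₂, hμε₁, hμε₂⟩ := PowEncl.check_spec hμε
  rw [List.all_eq_true] at hEcells hOcells
  have hQ : ∀ p ∈ T.box, 1 / 2 < p.1 ∧ p.1 < 1 ∧ p.1 + 1 / 2 < p.2 := by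
    intro p hp
    obtain ⟨⟨h1, h2⟩, ⟨h3, _⟩⟩ := hp
    have e1 : ((1 / 2 : ℚ) : ℝ) < (T.σlo : ℝ) := by exact_mod_cast hσlo
    have e2 : (T.σhi : ℝ) < ((1 : ℚ) : ℝ) := by exact_mod_cast hσhi
    have e3 : ((T.σhi + 1 / 2 : ℚ) : ℝ) < (T.εlo : ℝ) := by exact_mod_cast hgap
    push_cast at e1 e2 e3
    exact ⟨by linarith, by linarith, by linarith⟩
  have hE₀' : (1 / 2 : ℝ) < ((T.E₀ : ℚ) : ℝ) := by
    have h : ((1 / 2 : ℚ) : ℝ) < ((T.E₀ : ℚ) : ℝ) := by exact_mod_cast hE₀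
    push_cast at h
    exact h
  refine boxExcluded_of_taylorConeObligations_half T.L.toFinset (fun k ab => (T.c k ab : ℝ)) T.Lψ.toFinset
    (fun ab => (T.ψ ab : ℝ)) (κ₀ := (T.κ₀ : ℝ)) (by exact_mod_cast hκ₀) (E₀ := ((T.E₀ : ℚ) : ℝ))
    (E_T := ((T.E_T : ℚ) : ℝ)) hE₀' hQ ?_
  refine TaylorConeObligations.of_oddCover ?hI ?hEc ?hEr
    (T.oddCells.map fun C => ⟨C.ℓ, C.lo, C.hi, C.F.toFinset⟩) ?hOcov ?hOhead ?hOF hC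
  -- (I) identity
  · exact identity_pos_of_kdCheck T.c hL hκhi hκr₁ hκr₂ hκ₁ hκ₂ htI hbI
  -- (E) even cells from the cover
  · refine evenCellField_of_cover _ T.box _ (T.evenCells.map fun C => ⟨C.ℓ, C.lo, C.hi, C.F.toFinset⟩)
      ?_ ?_ ?_ hR
    · -- cover
      rw [checkEvenCover, Bool.and_eq_true, Bool.and_eq_true, List.any_eq_true, List.all_eq_true] at hEcov
      obtain ⟨⟨⟨Cε, hCε, hCε'⟩, h3⟩, hℓ⟩ := hEcov
      rw [Bool.and_eq_true, Bool.and_eq_true, decide_eq_true_iff, decide_eq_true_iff, decide_eq_true_iff] at hCε'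
      obtain ⟨⟨hCε0, hCεlo⟩, hCεhi⟩ := hCε'
      refine evenCover_of_perSpin T.box _ _ T.LE (by exact_mod_cast hLE) ?_ ?_ ?_
      · intro p hp
        refine ⟨⟨Cε.ℓ, Cε.lo, Cε.hi, Cε.F.toFinset⟩, List.mem_map.mpr ⟨Cε, hCε, rfl⟩, hCε0, ?_, ?_⟩
        · exact le_trans (by exact_mod_cast hCεlo : ((Cε.lo : ℚ) : ℝ) ≤ (T.εlo : ℝ)) hp.2.1
        · exact le_trans hp.2.2 (by exact_mod_cast hCεhi : (T.εhi : ℝ) ≤ ((Cε.hi : ℚ) : ℝ))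
      · intro Δ h3Δ hΔE
        obtain ⟨I, hI, h1, h2⟩ := chainCovers_sound _ _ _ h3 Δ (by exact_mod_cast h3Δ) hΔE.le
        obtain ⟨C, hC, hCℓ, rfl⟩ := T.exists_evenCell_of_mem_ivls hI
        exact ⟨⟨C.ℓ, C.lo, C.hi, C.F.toFinset⟩, List.mem_map.mpr ⟨C, hC, rfl⟩, hCℓ, h1, h2⟩
      · intro ℓ hev h1ℓ hℓL Δ hbΔ hΔE
        have hch : chainCovers ((ℓ : ℚ) + 1) T.E₀ (T.evenIvls ℓ) = true := by
          have h := hℓ ℓ (List.mem_range.mpr hℓL)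
          rw [Bool.or_eq_true, Bool.or_eq_true, decide_eq_true_iff, Bool.not_eq_true', decide_eq_false_iff_not] at h
          rcases h with (h | h) | h
          · omega
          · exact absurd hev h
          · exact h
        obtain ⟨I, hI, h1, h2⟩ := chainCovers_sound _ _ _ hch Δ (by push_cast; exact hbΔ) hΔE.le
        obtain ⟨C, hC, hCℓ, rfl⟩ := T.exists_evenCell_of_mem_ivls hI
        exact ⟨⟨C.ℓ, C.lo, C.hi, C.F.toFinset⟩, List.mem_map.mpr ⟨C, hC, rfl⟩, hCℓ, h1, h2⟩
    · -- heads
      intro c hc p hp Δ ha hb _ _ _ a b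
      obtain ⟨C, hC, rfl⟩ := List.mem_map.mp hc
      have hcell := hEcells C hC
      simp only [checkEvenCell, Bool.and_eq_true, decide_eq_true_eq, List.all_eq_true] at hcell
      obtain ⟨⟨⟨⟨⟨⟨⟨hFnd, hFj⟩, hℓlo⟩, hAlen⟩, _⟩, hX⟩, hY⟩, hD⟩ := hcell
      exact evenHead_nonneg_of_kdCheck T.c hL C.ℓ hFnd (fun q hq => hFj q hq) hℓlo hAlen
        (hEnc.1 C hC) hX hY hD p hp Δ ha hb a b
    · -- off the head set
      intro c hc q hq hr
      obtain ⟨C, hC, rfl⟩ := List.mem_map.mp hc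
      have hcell := hEcells C hC
      simp only [checkEvenCell, Bool.and_eq_true, decide_eq_true_eq, List.all_eq_true] at hcell
      obtain ⟨⟨⟨⟨⟨⟨⟨_, _⟩, _⟩, _⟩, hcanon⟩, _⟩, _⟩, _⟩ := hcell
      exact offHead_of_canonOK hcanon q hq hr
  -- (E5) even region
  · exact hR
  -- odd cover
  · rw [checkOddCover, Bool.and_eq_true, Bool.and_eq_true, List.any_eq_true, List.all_eq_true] at hOcov
    obtain ⟨⟨⟨Cσ, hCσ, hCσ'⟩, h3⟩, hℓ⟩ := hOcov
    rw [Bool.and_eq_true, Bool.and_eq_true, decide_eq_true_iff, decide_eq_true_iff, decide_eq_true_iff] at hCσ'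
    obtain ⟨⟨hCσ0, hCσlo⟩, hCσhi⟩ := hCσ'
    refine oddCover_of_perSpin T.box _ _ T.LT (by exact_mod_cast hLT) ?_ ?_ ?_
    · intro p hp
      refine ⟨⟨Cσ.ℓ, Cσ.lo, Cσ.hi, Cσ.F.toFinset⟩, List.mem_map.mpr ⟨Cσ, hCσ, rfl⟩, hCσ0, ?_, ?_⟩
      · exact le_trans (by exact_mod_cast hCσlo : ((Cσ.lo : ℚ) : ℝ) ≤ (T.σlo : ℝ)) hp.1.1
      · exact le_trans hp.1.2 (by exact_mod_cast hCσhi : (T.σhi : ℝ) ≤ ((Cσ.hi : ℚ) : ℝ))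
    · intro Δ h3Δ hΔE
      obtain ⟨I, hI, h1, h2⟩ := chainCovers_sound _ _ _ h3 Δ (by exact_mod_cast h3Δ) hΔE.le
      obtain ⟨C, hC, hCℓ, rfl⟩ := T.exists_oddCell_of_mem_ivls hI
      exact ⟨⟨C.ℓ, C.lo, C.hi, C.F.toFinset⟩, List.mem_map.mpr ⟨C, hC, rfl⟩, hCℓ, h1, h2⟩
    · intro ℓ h1ℓ hℓL Δ hbΔ hΔE
      have hch : chainCovers ((ℓ : ℚ) + 1) T.E_T (T.oddIvls ℓ) = true := by
        have h := hℓ ℓ (List.mem_range.mpr hℓL)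
        rw [Bool.or_eq_true, decide_eq_true_iff] at h
        rcases h with h | h
        · omega
        · exact h
      obtain ⟨I, hI, h1, h2⟩ := chainCovers_sound _ _ _ hch Δ (by push_cast; exact hbΔ.le) hΔE.le
      obtain ⟨C, hC, hCℓ, rfl⟩ := T.exists_oddCell_of_mem_ivls hI
      exact ⟨⟨C.ℓ, C.lo, C.hi, C.F.toFinset⟩, List.mem_map.mpr ⟨C, hC, rfl⟩, hCℓ, h1, h2⟩
  -- odd heads (regularised: uses the strict hypothesis `b_ℓ < Δ`)
  · intro c hc p hp Δ ha hb hbΔ _ _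
    obtain ⟨C, hC, rfl⟩ := List.mem_map.mp hc
    have hcell := hOcells C hC
    simp only [checkOddCell, Bool.and_eq_true, decide_eq_true_eq, List.all_eq_true] at hcell
    obtain ⟨⟨⟨⟨⟨hFnd, hFj⟩, hℓlo⟩, hAlen⟩, _⟩, ht⟩ := hcell
    exact oddHead_nonneg_of_kdCheck_reg T.c hL T.ψ hLψ T.κ₀ C.ℓ hFnd (fun q hq => hFj q hq) hℓlo
      hκhi hκr₁ hκr₂ hκ₁ hκ₂ hμσhi hμσr₁ hμσr₂ hμσ₁ hμσ₂ hμεhi hμεr₁ hμεr₂ hμε₁ hμε₂ hAlen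
      (hEnc.2 C hC) ht p hp Δ ha hb hbΔ
  -- off the odd head sets
  · intro c hc q hq hr
    obtain ⟨C, hC, rfl⟩ := List.mem_map.mp hc
    have hcell := hOcells C hC
    simp only [checkOddCell, Bool.and_eq_true, decide_eq_true_eq, List.all_eq_true] at hcell
    obtain ⟨⟨⟨⟨⟨_, _⟩, _⟩, _⟩, hcanon⟩, _⟩ := hcell
    exact offHead_of_canonOK hcanon q hq hr

end TaylorTable

end Summit.CriticalPhenomena.Ising3D
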